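import Summits.QuantumFields.YangMills.Theorems.BalabanLadderROTOnClassLimit
import Summits.QuantumFields.YangMills.Theorems.BalabanLadderROTTiltSplit
import Summits.QuantumFields.YangMills.Theorems.BalabanLadderROTKingHierarchy
import Summits.QuantumFields.YangMills.Theorems.BalabanLadderROTGuardIR
import Summits.QuantumFields.YangMills.Theorems.BalabanLadderROTBridgeOnClass
import HarnessLib

/-!
# Crux `ROT` (stmt-QuantumFields-20042): the two revisions of the route decl BY NAME — certificate, monotone links, re-targeted closers

Helper file (`--supports stmt-QuantumFields-20042 --as helper`) of the fleet lead `ym-spine-20042-p1` (generation g3), answering the route owner's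
located ask of 2026-08-26T20:55:29Z (R85 importer census, `R85-BATCH-EDITS.md` rev 3e item 5b (b)).  Companion of
`Theorems/BalabanLadderROTClassDefs.lean` §4 (`ROTRev1`, `ROTRev2'` — named, `Theses`-free copies of the rev-1…9 text and of the rev-2′ text of record).

* §1 CERTIFICATE `rotRev1_iff_rot : ROTRev1 ↔ Theses.BalabanLadder.ROT` (`Iff.rfl`: the named copy IS today's decl; this one line is the only
  thing here that the R85 restate touches — it becomes `rotRev2'_iff_rot`, same proof).
* §2 MONOTONE LINKS `rotRev2'_of_rotRev1` (rev 1 ⇒ rev 2′, `S = univ`), `rotRev2'_of_rotIR` (rev 2 = IR-guarded all-schemes text ⇒ rev 2′),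
  `rotRev2'_of_rot` (today's decl ⇒ rev 2′).
* §3 PRODUCERS / CLOSERS BY NAME, so that every candidate skeleton closes the restated decl with a one-line `ROT_of`:
  `rotRev1_of_kingLimit` / `_of_kingSingle` / `_of_kingAll` (v3/v4 stubs ⇒ rev 1), `rotRev2'_of_kingOnClass` (owner's v6-of-record stub `KingOnClass`),
  `rotRev2'_of_kingLimitIROn` / `_five` (fixed-class variant), `rotRev2'_of_kingLimitIR` / `_of_kingSingleIR` (rev-2 candidates), `rotRev2'_of_tilt345`
  (the split `NROT3 ∧ TI`).

* §4 `closes_of_rotRev2'` — `UV → UVSeamRec → NT → IR → ROTRev2' → UVOtherGroups → YangMills` (today's other five items, bridge re-run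
  on the returned class): the in-tree twin of the owner's `closes_R85'`.

* §5 `kingSingleIROn_of_tilt`, `kingLimitIROn_five_of_tilt345` (the split feeds the fixed-class stub too), antitonicity of `NROT3`/`TI` in the class.

All proofs are the landed ones seen through the definitional equalities `ROTRev1 ≡ ‹rev-1 body›`, `ROTRev2' ≡ ‹rev-2′ body›`.  No definition, no sorry;
nothing asserted about Yang–Mills.
-/

set_option autoImplicit false

noncomputable section

open MeasureTheory Filter Topology
open Literature.MathematicalPhysics.QuantumFieldTheory Literature.MathematicalPhysics.QuantumLattice
open Summit.QuantumFields.YangMills.Cruxes.OSLegsFromFemtoAndGap.DlrCollarTransfer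
open Summit.QuantumFields.YangMills.Cruxes.OSLegsAtWeakCouplingC.Y2Bridge

namespace Summit.QuantumFields.YangMills.Theorems.ROT


/-! ## §1 Certificate: the named copy is today's decl -/

/-- **`ROTRev1` is, definitionally, the route decl `Theses.BalabanLadder.ROT` as filed today** (revisions 1–9).  At the R85 restate this line is
replaced by `rotRev2'_iff_rot` with the same proof. [folklore] -/
theorem rotRev1_iff_rot : ROTRev1 ↔ Summit.QuantumFields.YangMills.Theses.BalabanLadder.ROT := Iff.rfl

/-! ## §2 Monotone links between the revisions -/

/-- **rev 1 ⇒ rev 2′**: the all-schemes Ward leg gives the Ward leg on the class of all tori (`S = univ`, unbounded); the infrared guard is not used.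
[folklore] -/
theorem rotRev2'_of_rotRev1 (h : ROTRev1) : ROTRev2' := by
  intro G _ _ _ _ hG
  letI : MeasurableSpace G := borel G
  haveI : BorelSpace G := ⟨rfl⟩
  intro r a ha ha0 hLB hUV _
  exact ⟨Set.univ, fun N => ⟨N, Set.mem_univ _, le_rfl⟩, latticeRotWardOn_of_latticeRotWard r a _ (h G hG r a ha ha0 hLB hUV)⟩

/-- **rev 2 ⇒ rev 2′**: the IR-guarded all-schemes text (the `hROT` binder of `Theorems.ROT.closes_of_rotIR`) gives rev 2′ with `S = univ`. [folklore] -/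
theorem rotRev2'_of_rotIR
    (h : ∀ (G : Type) [Group G] [TopologicalSpace G] [IsTopologicalGroup G] [CompactSpace G],
      IsCompactSimpleLieGroup G → letI : MeasurableSpace G := borel G; haveI : BorelSpace G := ⟨rfl⟩;
      ∀ (r : LatticeRep G) (a : ℝ → ℝ), (∀ β, 0 < a β) → Tendsto a atTop (𝓝 0) →
        LowerBounds G r a → MomentBounds6 G r a → GapInUnits G r a → LatticeRotWard G r a) :
    ROTRev2' := by
  intro G _ _ _ _ hG
  letI : MeasurableSpace G := borel G
  haveI : BorelSpace G := ⟨rfl⟩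
  intro r a ha ha0 hLB hUV hIR
  exact ⟨Set.univ, fun N => ⟨N, Set.mem_univ _, le_rfl⟩, latticeRotWardOn_of_latticeRotWard r a _ (h G hG r a ha ha0 hLB hUV hIR)⟩

/-- **Today's decl ⇒ rev 2′** (pre-edit form of the monotone link; at the restate it becomes the identity). [folklore] -/
theorem rotRev2'_of_rot (h : Summit.QuantumFields.YangMills.Theses.BalabanLadder.ROT) : ROTRev2' :=
  rotRev2'_of_rotRev1 (rotRev1_iff_rot.2 h)

/-! ## §3 Producers and closers by name -/

/-- **v4 stub ⇒ rev 1 by name**: `KingLimit → ROTRev1` (the landed `rot_of_kingLimit`). [C. King, CMP 103 (1986) Thm 2.4 — mechanism] -/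
theorem rotRev1_of_kingLimit (h : KingLimit) : ROTRev1 := rot_of_kingLimit h

/-- `KingSingle → ROTRev1` (the landed `rot_of_kingSingle`). [C. King, CMP 103 (1986) Thm 2.4 — mechanism] -/
theorem rotRev1_of_kingSingle (h : KingSingle) : ROTRev1 := rot_of_kingSingle h

/-- `KingAll → ROTRev1` (the landed `rot_of_kingAll`). [C. King, CMP 103 (1986) Thm 2.4 — mechanism] -/
theorem rotRev1_of_kingAll (h : KingAll) : ROTRev1 := rot_of_kingAll h

/-- **The owner's v6-of-record stub closes rev 2′ by name**: `KingOnClass → ROTRev2'` (the landed `rot2'_of_kingOnClass`); after the restate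
`theorem ROT_of : Theses.BalabanLadder.ROT := rotRev2'_of_kingOnClass stub_kingOnClass`. [C. King, CMP 103 (1986) Thm 2.4 — mechanism] -/
theorem rotRev2'_of_kingOnClass (h : KingOnClass) : ROTRev2' := rot2'_of_kingOnClass h

/-- **Fixed-class variant**: `UnboundedClass S → KingLimitIROn S → ROTRev2'` (the landed `rot2'_of_kingLimitIROn`). [C. King, CMP 103 (1986) Thm 2.4 —
mechanism] -/
theorem rotRev2'_of_kingLimitIROn {S : Set ℕ} (hS : UnboundedClass S) (h : KingLimitIROn S) : ROTRev2' := rot2'_of_kingLimitIROn hS h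

/-- `KingLimitIROn {L | 5 ∣ 2L+1} → ROTRev2'` (King's class). [C. King, CMP 103 (1986) Thm 2.4 — mechanism] -/
theorem rotRev2'_of_kingLimitIROn_five (h : KingLimitIROn {L : ℕ | 5 ∣ 2 * L + 1}) : ROTRev2' := rot2'_of_kingLimitIROn_five h

/-- **rev-2 candidate stubs close rev 2′**: `KingSingleIR → ROTRev2'`. [C. King, CMP 103 (1986) Thm 2.4 — mechanism] -/
theorem rotRev2'_of_kingSingleIR (h : KingSingleIR) : ROTRev2' := rot2'_of_kingOnClass (kingOnClass_of_kingSingleIR h)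

/-- `KingLimitIR → ROTRev2'`. [C. King, CMP 103 (1986) Thm 2.4 — mechanism] -/
theorem rotRev2'_of_kingLimitIR (h : KingLimitIR) : ROTRev2' := rotRev2'_of_kingSingleIR (kingLimitIR_iff_kingSingleIR.1 h)

/-- **The split closes rev 2′ by name**: `NROT3 ∧ TI` at King's `(4,3,5)` tilt cell on the fitted class `5 ∣ 2L+1` (the landed `rot2'_of_tilt345`;
candidate skeleton v5″). [C. King, CMP 103 (1986) Thm 2.4 / II (2.24)–(2.25) — mechanism] -/
theorem rotRev2'_of_tilt345 (h3 : NROT3 PythTriple.king345.tiltCell (Real.arcsin (3 / 5)) (PythTriple.fittedClass 5))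
    (hT : TI PythTriple.king345.tiltCell (PythTriple.fittedClass 5)) : ROTRev2' :=
  rot2'_of_tilt345 h3 hT

/-! ## §4 The rev-2′ rotation leg closes the route with today's other items (appended 2026-08-26, g3)

`Theses.BalabanLadder.closes` re-run with the rotation leg replaced by `ROTRev2'` (the text of record for R85 item 3): in both branches the UV leg
(`MomentBounds6`), the lower bounds and the infrared leg (`GapInUnits`) are in hand at the same `(r, a)` before the rotation leg is invoked; the
class `S` it returns is handed to the PROVED bridge re-run (`yangMills_of_legs_on`, from `bridgeOnClass`).  The in-tree twin of the owner's
pre-certified `closes_R85'` over TODAY's item set (cf. `closes_of_rotIR` for rev 2). -/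

/-- **`UV → UVSeamRec → NT → IR → ROTRev2' → UVOtherGroups → YangMills`**: the rev-2′ rotation leg closes route `BalabanLadder` with the
other five items of today unchanged (bridge re-run on the returned class). [folklore; glue] -/
theorem closes_of_rotRev2'
    (hUV : Summit.QuantumFields.YangMills.Theses.BalabanLadder.UV)
    (hSeam : Summit.QuantumFields.YangMills.Theses.BalabanLadder.UVSeamRec)
    (hNT : Summit.QuantumFields.YangMills.Theses.BalabanLadder.NT)
    (hIR : Summit.QuantumFields.YangMills.Theses.BalabanLadder.IR)
    (hROT : ROTRev2')
    (hOther : Summit.QuantumFields.YangMills.Theses.BalabanLadder.UVOtherGroups) :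
    YangMills := by
  -- adapted from `closes_of_rotIR` (Theorems/BalabanLadderROTGuardIR.lean, seat g2), bridge `yangMills_of_legs_on` (seat g2)
  have hu : ∀ β : ℝ, 0 < Real.exp (Summit.QuantumFields.YangMills.Theorems.FemtoTransferGap.sizeLog β 1) :=
    fun β => Real.exp_pos _
  have hu0 : Tendsto (fun β : ℝ => Real.exp (Summit.QuantumFields.YangMills.Theorems.FemtoTransferGap.sizeLog β 1))
      atTop (𝓝 0) :=
    Real.tendsto_exp_atBot.comp Summit.QuantumFields.YangMills.Cruxes.UVSeamRec.UnitTransfer.tendsto_sizeLog_one_atBot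
  refine yangMills_of_legs_on ?_
  intro G _ _ _ _ hG
  by_cases hcl : Nonempty (G ≃ₜ* Matrix.specialUnitaryGroup (Fin 2) ℂ)
  · obtain ⟨r, hlb, hmb⟩ := hSeam hUV G hG hcl
    have hir := hIR G hG r _ hu hu0 hlb
    obtain ⟨S, hS, hrot⟩ := hROT G hG r _ hu hu0 hlb hmb hir
    exact ⟨r, _, hu, hu0, hmb, hlb, hir, S, hS, hrot⟩
  · obtain ⟨r, a, ha, ha0, hlb⟩ := hNT G hG
    have hmb := hOther G hG (not_nonempty_iff.mp hcl) r a ha ha0 hlb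
    have hir := hIR G hG r a ha ha0 hlb
    obtain ⟨S, hS, hrot⟩ := hROT G hG r a ha ha0 hlb hmb hir
    exact ⟨r, a, ha, ha0, hmb, hlb, hir, S, hS, hrot⟩

/-- **Today's route still closes through the rev-2′ leg** (sanity: rev 1 ⇒ rev 2′ ⇒ `YangMills` with the other five items). [folklore; glue] -/
theorem closes_via_rotRev2'
    (hUV : Summit.QuantumFields.YangMills.Theses.BalabanLadder.UV)
    (hSeam : Summit.QuantumFields.YangMills.Theses.BalabanLadder.UVSeamRec)
    (hNT : Summit.QuantumFields.YangMills.Theses.BalabanLadder.NT)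
    (hIR : Summit.QuantumFields.YangMills.Theses.BalabanLadder.IR)
    (hROT : Summit.QuantumFields.YangMills.Theses.BalabanLadder.ROT)
    (hOther : Summit.QuantumFields.YangMills.Theses.BalabanLadder.UVOtherGroups) :
    YangMills :=
  closes_of_rotRev2' hUV hSeam hNT hIR (rotRev2'_of_rot hROT) hOther

/-! ## §5 The split feeds EVERY candidate stub (appended 2026-08-26, g3): `NROT3 ∧ TI` on a class ⇒ the King texts on that class

`TiltedRegComparisonOn ∧ TiltInsensitivityOn ⇒ LatticeKingWardOn {θ}` is per `(G, r, a)` and per scheme (`latticeKingWardOn_of_tilt`, p4 g18), so the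
guarded halves give the guarded King texts on the SAME class: at King's data `(4,3,5)`, `θ = arcsin (3/5)`, `S₅ = fittedClass 5 = {L | 5 ∣ 2L+1}`
(definitionally the class of `KingLimitIROn`'s v6-alt stub) they give `KingSingleIROn S₅`, hence `KingLimitIROn S₅`; and both halves are antitone
in the class.  So work on the two split stubs transfers to whichever single-stub skeleton is registered (v6 of record `KingOnClass` via
`kingOnClass_of_tilt345`; fixed-class `KingLimitIROn S₅` via `kingLimitIROn_five_of_tilt345`). -/

/-- **`NROT3 ∧ TI ⇒ KingSingleIROn` on the same class**, for any cell family at King's angle. [C. King, CMP 103 (1986) Thm 2.4 — mechanism] -/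
theorem kingSingleIROn_of_tilt (C : ℕ → PeriodCell 4) {S : Set ℕ} (h3 : NROT3 C (Real.arcsin (3 / 5)) S) (hT : TI C S) :
    KingSingleIROn S := by
  intro G _ _ _ _ hG
  letI : MeasurableSpace G := borel G
  haveI : BorelSpace G := ⟨rfl⟩
  intro r a ha ha0 hUV hIR
  exact latticeKingWardOn_of_tilt r a C _ S (h3 G hG r a ha ha0 hUV hIR) (hT G hG r a ha ha0 hUV hIR)

/-- **The v5″ split stubs give the fixed-class v6-alt stub**: `NROT3 ∧ TI` at King's `(4,3,5)` cells on `5 ∣ 2L+1` ⇒ `KingLimitIROn {L | 5 ∣ 2L+1}`.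
[C. King, CMP 103 (1986) Thm 2.4 — mechanism] -/
theorem kingLimitIROn_five_of_tilt345 (h3 : NROT3 PythTriple.king345.tiltCell (Real.arcsin (3 / 5)) (PythTriple.fittedClass 5))
    (hT : TI PythTriple.king345.tiltCell (PythTriple.fittedClass 5)) : KingLimitIROn {L : ℕ | 5 ∣ 2 * L + 1} :=
  kingLimitIROn_of_kingSingleIROn (kingSingleIROn_of_tilt _ h3 hT)

section Anti

variable {G : Type} [Group G] [TopologicalSpace G] [IsTopologicalGroup G] [CompactSpace G] [MeasurableSpace G] [BorelSpace G]

/-- The regularisation-comparison statement is antitone in the class. [folklore] -/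
theorem tiltedRegComparisonOn_anti (r : LatticeRep G) (a : ℝ → ℝ) (C : ℕ → PeriodCell 4) (θ : ℝ) {S T : Set ℕ} (h : S ⊆ T)
    (hT : TiltedRegComparisonOn G r a C θ T) : TiltedRegComparisonOn G r a C θ S :=
  fun sch hS hunits hβ hranges => hT sch (fun k => h (hS k)) hunits hβ hranges

/-- The tilt-insensitivity statement is antitone in the class. [folklore] -/
theorem tiltInsensitivityOn_anti (r : LatticeRep G) (a : ℝ → ℝ) (C : ℕ → PeriodCell 4) {S T : Set ℕ} (h : S ⊆ T)
    (hT : TiltInsensitivityOn G r a C T) : TiltInsensitivityOn G r a C S :=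
  fun sch hS hunits hβ hranges => hT sch (fun k => h (hS k)) hunits hβ hranges

end Anti

/-- `NROT3` is antitone in the class. [folklore] -/
theorem nrot3_anti (C : ℕ → PeriodCell 4) (θ : ℝ) {S T : Set ℕ} (h : S ⊆ T) (hT : NROT3 C θ T) : NROT3 C θ S := by
  intro G _ _ _ _ hG
  letI : MeasurableSpace G := borel G
  haveI : BorelSpace G := ⟨rfl⟩
  intro r a ha ha0 hUV hIR
  exact tiltedRegComparisonOn_anti r a C θ h (hT G hG r a ha ha0 hUV hIR)

/-- `TI` is antitone in the class. [folklore] -/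
theorem ti_anti (C : ℕ → PeriodCell 4) {S T : Set ℕ} (h : S ⊆ T) (hT : TI C T) : TI C S := by
  intro G _ _ _ _ hG
  letI : MeasurableSpace G := borel G
  haveI : BorelSpace G := ⟨rfl⟩
  intro r a ha ha0 hUV hIR
  exact tiltInsensitivityOn_anti r a C h (hT G hG r a ha ha0 hUV hIR)

end Summit.QuantumFields.YangMills.Theorems.ROT

end
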